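import Summits.BirchSwinnertonDyer.BirchSwinnertonDyer.Theorems.ByReductionTypeAtTwoFineSelmerConjAAtTwoAdditivePotGoodClassNumberOddCriterion
import Summits.BirchSwinnertonDyer.BirchSwinnertonDyer.Theorems.ByReductionTypeAtTwoFineSelmerConjAAtTwoAdditivePotGoodCensusDoorStampsB
import HarnessLib

/-!
# Route `ByReductionTypeAtTwo` (rung K4), crux C1″ `FineSelmerConjAAtTwoAdditivePotGood` (item stmt-BirchSwinnertonDyer-22615):
# ODD CLASS NUMBER (h = 3 IN THE CENSUS) FOR THE CUBIC FIELD OF DISCRIMINANT `−22572` (`X³ + (0)X² + (-12)X + (-60)`, index `2`) BY A NORM CERTIFICATE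
# (KERNEL) — the `2`-torsion point field `ℚ(P)` of the census row `451440ch1`, whose census stamp thereby needs NO displayed datum any more ((A)₂ modulo Lim 2017 Thm. 3.5 ALONE)
# (a `--supports 22615` file; seat `bsd-2adic-k4-w1` GEN 6; consumer of `…ClassNumberOneCriterion` / `…ClassNumberOneCriterionFrac`)

HONEST FRAMING (cell `bsd-2adic`, D-0036/D-0054): §1 UNCONDITIONAL kernel arithmetic; §2 conditional on `hLim2` (Lim 2017 Thm. 3.5 at `2`) BY NAME
and NOTHING ELSE; closes nothing at the `∀`-level; nothing booked; BSD is not proved by any of this.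

THE CERTIFICATE (generated by the seat's exact-arithmetic tools — reduced model, integral basis, relation sieve with Dedekind–Kummer
bookkeeping, unit reduction — and CHECKED HERE by the kernel): `g = X³ + (0)X² + (-12)X + (-60)`, `disc g = 90288 = 2² · (-22572)`;
the integral element `ω` of the proof shows `2 ∣ [𝓞 K : ℤ[θ]]`, so `|d_K| ≤ 22572` (`sq_mul_abs_discr_le_abs_cubic_discr`) and `M_K < 43`.
For every prime `ℓ < 43` and every root `a` of `g mod ℓ` the proof lists a generator `(x + yθ + zθ²)/m` of the ideals `I ∋ ℓ, θ − a` of norm `ℓ`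
(16 witnesses, 8 of them outside `ℤ[θ]`, 13 of them CUBE witnesses (I³ = (ω), with Bézout identity and lift); the prime 2 dividing the index is certified through a second generator of `𝓞 K` (`exists_intElem_of_scaled_cubic`)). No Dedekind–Kummer theory is invoked in the proof: the criterion only uses `𝓞/I ≅ 𝔽_ℓ`.

References: [Marcus1977] Ch. 2 Exercise 27, Ch. 5 Thm. 35–37; [Cohen1993] §4.8.2, §6.3; [Lim2017FineSelmer] Thm. 3.5, Lemma 3.2;
[Greenberg2001IwasawaPastPresent] Prop. 2.1 (Iwasawa 1956); [Fukuda1994] Thm. 1 (1).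
-/

set_option autoImplicit false
-- sibling precedent (`…ClassNumberOneCriterionFrac.lean`): the directory name repeats the summit name
set_option linter.dupNamespace false

noncomputable section

open scoped Classical IntermediateField NumberField Real nonZeroDivisors

namespace Summit.BirchSwinnertonDyer.BirchSwinnertonDyer.Theorems.AddKatoTwo

open WeierstrassCurve Field Polynomial IsDedekindDomain NumberField Matrix Literature.NumberTheory.EllipticCurves
  Literature.NumberTheory.GaloisRepresentations
  Literature.NumberTheory.IwasawaTheory
  Summit.BirchSwinnertonDyer.BirchSwinnertonDyer.Theorems.AlignedTransportAtTwoTorsionPointField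
  Summit.BirchSwinnertonDyer.BirchSwinnertonDyer.Theses.ByReductionTypeAtTwo

/-! ## §1 The certificate: `h` odd for the field of `X³ + (0)X² + (-12)X + (-60)` -/

section Certificate

variable (K : Type) [Field K] [NumberField K]

/-- `X³ + (0)X² + (-12)X + (-60)` is irreducible over `ℚ` (no root mod `13`). -/
theorem irreducible_cubic_d22572n : Irreducible (Cubic.toPoly ⟨1, ((0 : ℤ) : ℚ), ((-12 : ℤ) : ℚ), ((-60 : ℤ) : ℚ)⟩) :=
  haveI : Fact (Nat.Prime 13) := ⟨by norm_num⟩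
  irreducible_cubic_of_no_root_zmod 13 (by decide)

/-- `X³ + (0)X² + (66)X + (-242)` is irreducible over `ℚ` (no root mod `13`). -/
theorem irreducible_cubic_d22572n_aux2 : Irreducible (Cubic.toPoly ⟨1, ((0 : ℤ) : ℚ), ((66 : ℤ) : ℚ), ((-242 : ℤ) : ℚ)⟩) :=
  haveI : Fact (Nat.Prime 13) := ⟨by norm_num⟩
  irreducible_cubic_of_no_root_zmod 13 (by decide)

/-- **`h` is ODD for every cubic number field whose integers contain a root `θ` of `X³ + (0)X² + (-12)X + (-60)`** (`|disc| = 90288`, index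
`2`, `M_K < 43`): a norm certificate — for every prime `ℓ < 43` and every root `a` of the cubic mod `ℓ` a generator
of the CUBE (or of the ideal itself) `(x + yθ + zθ²)/m ∈ 𝓞 K` of every ideal `I ∋ ℓ, θ − a` of norm `ℓ` (listed in the proof; `m > 1` = element of `𝓞 K ∖ ℤ[θ]`, certified by its
scaled cubic identity); the primes dividing the index (2) are certified through a second generator of `𝓞 K`. KERNEL.
[cite: Marcus1977, Ch. 5 Thm. 37 and Cor. 2] [cite: Cohen1993, §6.3] -/
theorem odd_classNumber_of_root_d22572n (h3 : Module.finrank ℚ K = 3) (b : 𝓞 K)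
    (hb : b ^ 3 + (0 : ℤ) * b ^ 2 + (-12 : ℤ) * b + (-60 : ℤ) = 0) : Odd (NumberField.classNumber K) := by
  have hirr := irreducible_cubic_d22572n
  -- `ω = (0 + 0θ + 1θ²)/2 ∈ 𝓞 K` witnesses `2 ∣ [𝓞 K : ℤ[θ]]`, so `2² · |d_K| ≤ |disc| = 90288`
  obtain ⟨ω, hω, -⟩ := exists_intElem_of_scaled_cubic K b 0 0 1 (m := 2) (by norm_num) (-12) 36 (-450)
    (by push_cast; linear_combination ((60 : 𝓞 K) + (-12 : 𝓞 K) * b + (1 : 𝓞 K) * b ^ 3) * hb)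
  have hd : |NumberField.discr K| ≤ (22572 : ℕ) :=
    abs_discr_le_of_sq_mul_le K (k := 2) (by norm_num)
      (sq_mul_abs_discr_le_abs_cubic_discr K h3 b hirr hb (by norm_num) 0 0 1 ⟨ω, hω⟩ (by norm_num))
      (by simp only [Cubic.discr]; norm_num)
  -- second generator `b2 = (-8 + -2θ + 1θ²)/2`, a root of `X³ + (0)X² + (66)X + (-242)` (index 11, prime to 2)
  obtain ⟨b2, -, hb2⟩ := exists_intElem_of_scaled_cubic K b (-8) (-2) 1 (m := 2) (by norm_num) 0 66 (-242)
    (by push_cast; linear_combination ((76 : 𝓞 K) + (-6 : 𝓞 K) * b ^ 2 + (1 : 𝓞 K) * b ^ 3) * hb)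
  have hirr2 := irreducible_cubic_d22572n_aux2
  refine odd_classNumber_of_cubeCertificate K h3 (B := 43)
    (minkowskiBound_lt_of_sqrt_le K h3 hd (s := 150.24)
      ((Real.sqrt_le_sqrt (by norm_num : ((22572 : ℕ) : ℝ) ≤ (150.24 : ℝ) ^ 2)).trans (Real.sqrt_sq (by norm_num)).le)
      (by norm_num)) ?_
  intro ℓ hℓB hℓ J hJ
  interval_cases ℓ <;> norm_num at hℓ
  · -- `ℓ = 2`: roots [0] (second generator `b2`)
    refine pow_three_eq_span_of_cert K h3 b2 hirr2 hb2 (by norm_num) (fun a ha hdvd => ?_) hJ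
    interval_cases a <;> norm_num at hdvd
    · exact Or.inr ⟨2, 0, 0, 1, by norm_num, by norm_num, ⟨_, by rw [Nat.cast_one, one_mul]⟩, by norm_num,
        ⟨3, 0, 0, 0, (-121), 33, 0, by push_cast; linear_combination ((-1 : 𝓞 K)) * hb2⟩, ⟨0, by norm_num⟩⟩
  · -- `ℓ = 3`: roots [0]
    refine pow_three_eq_span_of_cert K h3 b hirr hb (by norm_num) (fun a ha hdvd => ?_) hJ
    interval_cases a <;> norm_num at hdvd
    · exact Or.inr ⟨3, 0, 0, 1, by norm_num, by norm_num, ⟨_, by rw [Nat.cast_one, one_mul]⟩, by norm_num,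
        ⟨3, 0, 0, 0, (-20), (-4), 0, by push_cast; linear_combination ((-1 : 𝓞 K)) * hb⟩, ⟨0, by norm_num⟩⟩
  · -- `ℓ = 5`: roots [0]
    refine pow_three_eq_span_of_cert K h3 b hirr hb (by norm_num) (fun a ha hdvd => ?_) hJ
    interval_cases a <;> norm_num at hdvd
    · exact Or.inl ⟨(-5), 1, 0, 1, by norm_num, by norm_num, ⟨_, by rw [Nat.cast_one, one_mul]⟩, by norm_num⟩
  · -- `ℓ = 7`: roots [6]
    refine pow_three_eq_span_of_cert K h3 b hirr hb (by norm_num) (fun a ha hdvd => ?_) hJ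
    interval_cases a <;> norm_num at hdvd
    · exact Or.inl ⟨(-34), 2, 1, 2, by norm_num, by norm_num, (exists_intElem_of_scaled_cubic K b (-34) 2 1 (m := 2) (by norm_num) 39 393 (-7)
          (by push_cast; linear_combination ((44 : 𝓞 K) + (6 : 𝓞 K) * b ^ 2 + (1 : 𝓞 K) * b ^ 3) * hb)).imp (fun _ h => h.1), by norm_num⟩
  · -- `ℓ = 11`: roots [4, 9]
    refine pow_three_eq_span_of_cert K h3 b hirr hb (by norm_num) (fun a ha hdvd => ?_) hJ
    interval_cases a <;> norm_num at hdvd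
    · exact Or.inr ⟨1, (-15), 3, 1, by norm_num, by norm_num, ⟨_, by rw [Nat.cast_one, one_mul]⟩, by norm_num,
        ⟨1, 10, 2, 0, 34, (-7), 0, by push_cast; linear_combination ((6 : 𝓞 K)) * hb⟩, ⟨0, by norm_num⟩⟩
    · exact Or.inr ⟨(-34), (-12), (-3), 2, by norm_num, by norm_num, (exists_intElem_of_scaled_cubic K b (-34) (-12) (-3) (m := 2) (by norm_num) 87 363 1331
          (by push_cast; linear_combination ((-2052 : 𝓞 K) + (-972 : 𝓞 K) * b + (-324 : 𝓞 K) * b ^ 2 + (-27 : 𝓞 K) * b ^ 3) * hb)).imp (fun _ h => h.1), by norm_num,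
        ⟨2, 7, 0, 0, (-29), (-6), (-2), by push_cast; linear_combination ((0 : 𝓞 K)) * hb⟩, ⟨0, by norm_num⟩⟩
  · -- `ℓ = 13`: roots none
    refine pow_three_eq_span_of_cert K h3 b hirr hb (by norm_num) (fun a ha hdvd => ?_) hJ
    interval_cases a <;> norm_num at hdvd
  · -- `ℓ = 17`: roots [9, 11, 14]
    refine pow_three_eq_span_of_cert K h3 b hirr hb (by norm_num) (fun a ha hdvd => ?_) hJ
    interval_cases a <;> norm_num at hdvd
    · exact Or.inr ⟨(-238), 4, 9, 2, by norm_num, by norm_num, (exists_intElem_of_scaled_cubic K b (-238) 4 9 (m := 2) (by norm_num) 249 18027 4913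
          (by push_cast; linear_combination ((39916 : 𝓞 K) + (-8316 : 𝓞 K) * b + (972 : 𝓞 K) * b ^ 2 + (729 : 𝓞 K) * b ^ 3) * hb)).imp (fun _ h => h.1), by norm_num,
        ⟨1, 16, 15, 0, 253, (-111), 12, by push_cast; linear_combination ((135 : 𝓞 K)) * hb⟩, ⟨0, by norm_num⟩⟩
    · exact Or.inl ⟨(-14), (-2), 1, 2, by norm_num, by norm_num, (exists_intElem_of_scaled_cubic K b (-14) (-2) 1 (m := 2) (by norm_num) 9 93 (-17)
          (by push_cast; linear_combination ((76 : 𝓞 K) + (-6 : 𝓞 K) * b ^ 2 + (1 : 𝓞 K) * b ^ 3) * hb)).imp (fun _ h => h.1), by norm_num⟩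
    · exact Or.inr ⟨(-29), (-13), (-3), 1, by norm_num, by norm_num, ⟨_, by rw [Nat.cast_one, one_mul]⟩, by norm_num,
        ⟨1, 9, 11, 0, (-131), (-49), (-10), by push_cast; linear_combination ((-33 : 𝓞 K)) * hb⟩, ⟨0, by norm_num⟩⟩
  · -- `ℓ = 19`: roots [2, 15]
    refine pow_three_eq_span_of_cert K h3 b hirr hb (by norm_num) (fun a ha hdvd => ?_) hJ
    interval_cases a <;> norm_num at hdvd
    · exact Or.inr ⟨(-26), (-12), 3, 2, by norm_num, by norm_num, (exists_intElem_of_scaled_cubic K b (-26) (-12) 3 (m := 2) (by norm_num) 3 1083 6859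
          (by push_cast; linear_combination ((1188 : 𝓞 K) + (972 : 𝓞 K) * b + (-324 : 𝓞 K) * b ^ 2 + (27 : 𝓞 K) * b ^ 3) * hb)).imp (fun _ h => h.1), by norm_num,
        ⟨2, 13, 0, 0, (-18), (-8), 2, by push_cast; linear_combination ((0 : 𝓞 K)) * hb⟩, ⟨0, by norm_num⟩⟩
    · exact Or.inr ⟨(-31), (-15), (-3), 1, by norm_num, by norm_num, ⟨_, by rw [Nat.cast_one, one_mul]⟩, by norm_num,
        ⟨1, 16, 12, 0, (-139), (-55), (-12), by push_cast; linear_combination ((-36 : 𝓞 K)) * hb⟩, ⟨0, by norm_num⟩⟩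
  · -- `ℓ = 23`: roots [3]
    refine pow_three_eq_span_of_cert K h3 b hirr hb (by norm_num) (fun a ha hdvd => ?_) hJ
    interval_cases a <;> norm_num at hdvd
    · exact Or.inr ⟨11, 13, (-3), 1, by norm_num, by norm_num, ⟨_, by rw [Nat.cast_one, one_mul]⟩, by norm_num,
        ⟨1, 18, 13, 0, (-93), (-4), 5, by push_cast; linear_combination ((-39 : 𝓞 K)) * hb⟩, ⟨0, by norm_num⟩⟩
  · -- `ℓ = 29`: roots [22]
    refine pow_three_eq_span_of_cert K h3 b hirr hb (by norm_num) (fun a ha hdvd => ?_) hJ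
    interval_cases a <;> norm_num at hdvd
    · exact Or.inr ⟨(-187), (-16), 11, 1, by norm_num, by norm_num, ⟨_, by rw [Nat.cast_one, one_mul]⟩, by norm_num,
        ⟨1, 5, 27, 0, 583, (-54), (-13), by push_cast; linear_combination ((297 : 𝓞 K)) * hb⟩, ⟨0, by norm_num⟩⟩
  · -- `ℓ = 31`: roots [16]
    refine pow_three_eq_span_of_cert K h3 b hirr hb (by norm_num) (fun a ha hdvd => ?_) hJ
    interval_cases a <;> norm_num at hdvd
    · exact Or.inr ⟨(-38), 170, (-33), 2, by norm_num, by norm_num, (exists_intElem_of_scaled_cubic K b (-38) 170 (-33) (m := 2) (by norm_num) 453 221085 29791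
          (by push_cast; linear_combination ((535220 : 𝓞 K) + (-2429856 : 𝓞 K) * b + (555390 : 𝓞 K) * b ^ 2 + (-35937 : 𝓞 K) * b ^ 3) * hb)).imp (fun _ h => h.1), by norm_num,
        ⟨1, 29, 8, 0, (-546), 47, 13, by push_cast; linear_combination ((-264 : 𝓞 K)) * hb⟩, ⟨1, by norm_num⟩⟩
  · -- `ℓ = 37`: roots [14]
    refine pow_three_eq_span_of_cert K h3 b hirr hb (by norm_num) (fun a ha hdvd => ?_) hJ
    interval_cases a <;> norm_num at hdvd
    · exact Or.inr ⟨98, 74, (-19), 2, by norm_num, by norm_num, (exists_intElem_of_scaled_cubic K b 98 74 (-19) (m := 2) (by norm_num) 81 44697 (-50653)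
          (by push_cast; linear_combination ((-326884 : 𝓞 K) + (-229824 : 𝓞 K) * b + (80142 : 𝓞 K) * b ^ 2 + (-6859 : 𝓞 K) * b ^ 3) * hb)).imp (fun _ h => h.1), by norm_num,
        ⟨1, 0, 35, 0, (-1078), (-123), 70, by push_cast; linear_combination ((-665 : 𝓞 K)) * hb⟩, ⟨0, by norm_num⟩⟩
  · -- `ℓ = 41`: roots [10]
    refine pow_three_eq_span_of_cert K h3 b hirr hb (by norm_num) (fun a ha hdvd => ?_) hJ
    interval_cases a <;> norm_num at hdvd
    · exact Or.inr ⟨(-62), (-50), 13, 2, by norm_num, by norm_num, (exists_intElem_of_scaled_cubic K b (-62) (-50) 13 (m := 2) (by norm_num) (-63) 21045 (-68921)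
          (by push_cast; linear_combination ((108220 : 𝓞 K) + (71136 : 𝓞 K) * b + (-25350 : 𝓞 K) * b ^ 2 + (2197 : 𝓞 K) * b ^ 3) * hb)).imp (fun _ h => h.1), by norm_num,
        ⟨1, 28, 4, 0, 34, (-25), 4, by push_cast; linear_combination ((52 : 𝓞 K)) * hb⟩, ⟨0, by norm_num⟩⟩

end Certificate

/-! ## §2 The census row `451440ch1` -/

/-- **(A)₂ for the census curve `451440ch1` modulo Lim 2017 Thm. 3.5 ALONE — NO displayed datum.** Its `2`-torsion cubic field
(`d = -22572`) has ODD `h` (census: `h = 3`) BY THE KERNEL (`odd_classNumber_of_root_d22572n`): the element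
`θ = -44217104/166375 + (-9483/166375)·β + (38/1497375)·β²` of `ℚ(β)` (`β` a root of the `2`-division cubic) is a root of `X³ + (0)X² + (-12)X + (-60)` and
`β = -912 + (555)·θ + (114)·θ²`, so `ℚ(P) = ℚ(β) = ℚ(θ)` (identities = `linear_combination`s of the `2`-division relation; coefficients
found by exact linear algebra in `ℚ[X]/(G)`). UPGRADES `conjA_two_451440ch1_of_oddClassNumber`. [cite: Lim2017FineSelmer, §3 Thm. 3.5 and Lemma 3.2]
[cite: Greenberg2001IwasawaPastPresent, Prop. 2.1 p. 339] [cite: Cohen1993, §6.3] -/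
theorem conjA_two_451440ch1
    (hLim2 : Lim2017.thm35_at_two_fineSelmerDual_moduleFinite_of_classicalMuVanishes_of_le_divisionField_four)
    (κ : ZpExtension ℚ 2) (hκ : κ.IsCyclotomic) :
    haveI := isElliptic_451440ch1'
    ∃ (γ : absoluteGaloisGroup ℚ) (D : (⟨0, ((0 : ℤ) : ℚ), 0, ((-15708708 : ℤ) : ℚ), ((-23965380468 : ℤ) : ℚ)⟩ : WeierstrassCurve ℚ).FineSelmerDualData κ γ),
      Module.Finite ℤ_[2] (RestrictScalars ℤ_[2] (IwasawaAlgebra 2) D.X) := by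
  haveI := isElliptic_451440ch1'
  obtain ⟨β, hβ⟩ : ∃ β : AlgebraicClosure ℚ, aeval β (Cubic.toPoly ⟨1, ((0 : ℤ) : ℚ), ((-15708708 : ℤ) : ℚ), ((-23965380468 : ℤ) : ℚ)⟩) = 0 :=
    IsAlgClosed.exists_aeval_eq_zero _ _ (by rw [Cubic.degree_of_a_ne_zero one_ne_zero]; norm_num)
  have hβ' : β ^ 3 + (0 : AlgebraicClosure ℚ) * β ^ 2 + (-15708708 : AlgebraicClosure ℚ) * β + (-23965380468 : AlgebraicClosure ℚ) = 0 := by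
    have := hβ
    simp only [Cubic.toPoly, map_one, one_mul, aeval_add, aeval_mul, aeval_C, aeval_X_pow, aeval_X,
      eq_ratCast, Rat.cast_intCast] at this
    push_cast at this
    linear_combination this
  set θ : AlgebraicClosure ℚ := algebraMap ℚ (AlgebraicClosure ℚ) (-44217104 / 166375 : ℚ) +
      algebraMap ℚ (AlgebraicClosure ℚ) (-9483 / 166375 : ℚ) * β + algebraMap ℚ (AlgebraicClosure ℚ) (38 / 1497375 : ℚ) * β ^ 2 with hθdef
  have hθ : aeval θ (Cubic.toPoly ⟨1, ((0 : ℤ) : ℚ), ((-12 : ℤ) : ℚ), ((-60 : ℤ) : ℚ)⟩) = 0 := by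
    simp only [Cubic.toPoly, map_one, one_mul, aeval_add, aeval_mul, aeval_C, aeval_X_pow, aeval_X, eq_ratCast,
      Rat.cast_intCast]
    rw [hθdef]
    simp only [eq_ratCast]
    push_cast
    linear_combination (((97381827288271 : AlgebraicClosure ℚ) / 124344897767578125) + ((-1406 : AlgebraicClosure ℚ) / 149475459375) * β + ((-4564484 : AlgebraicClosure ℚ) / 41448299255859375) * β ^ 2 + ((54872 : AlgebraicClosure ℚ) / 3357312239724609375) * β ^ 3) * hβ'
  have hadj : IntermediateField.adjoin ℚ {θ} = IntermediateField.adjoin ℚ {β} := by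
    apply le_antisymm
    · rw [IntermediateField.adjoin_simple_le_iff, hθdef]
      have hβmem := IntermediateField.mem_adjoin_simple_self ℚ β
      exact add_mem (add_mem (algebraMap_mem _ _) (mul_mem (algebraMap_mem _ _) hβmem))
        (mul_mem (algebraMap_mem _ _) (pow_mem hβmem 2))
    · rw [IntermediateField.adjoin_simple_le_iff]
      have hβeq : β = algebraMap ℚ (AlgebraicClosure ℚ) (-912 : ℚ) + algebraMap ℚ (AlgebraicClosure ℚ) (555 : ℚ) * θ +
          algebraMap ℚ (AlgebraicClosure ℚ) (114 : ℚ) * θ ^ 2 := by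
        rw [hθdef]; simp only [eq_ratCast]; push_cast; linear_combination (((9128968 : AlgebraicClosure ℚ) / 27680640625) + ((-54872 : AlgebraicClosure ℚ) / 747377296875) * β) * hβ'
      rw [hβeq]
      have hθmem := IntermediateField.mem_adjoin_simple_self ℚ θ
      exact add_mem (add_mem (algebraMap_mem _ _) (mul_mem (algebraMap_mem _ _) hθmem))
        (mul_mem (algebraMap_mem _ _) (pow_mem hθmem 2))
  refine conjA_two_451440ch1_of_oddClassNumber hLim2 hβ ?_ κ hκ
  rw [← hadj]
  exact not_two_dvd_card_classGroup_adjoin_of_forall_cubicField_odd irreducible_cubic_d22572n (odd_classNumber_of_root_d22572n) hθ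

end Summit.BirchSwinnertonDyer.BirchSwinnertonDyer.Theorems.AddKatoTwo

end
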